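import Summits.Ventures.Crystal3D.StickySpheres.FccStaircase
import HarnessLib

/-!
# `6N − 10·N^{2/3} ≤ C(N)` for every `N`: the all-`N` fcc lower bound with constant `10`

HONEST FRAMING. Part of the venture `Summits/Ventures/Crystal3D` (cell `pub-crystal3d`; seat p3 g11).
CONSTRUCTION SIDE ONLY [folklore]: the sticky-sphere contact number `C(N) = maxContacts 3 N` satisfies
**`six_mul_sub_ten_mul_rpow_le_maxContacts : 6·N − 10·N^{2/3} ≤ C(N)`** for every `N`, improving the
constant `54` of the tree's `six_mul_sub_rpow_le_maxContacts` (`Bulk/DefectCounting.lean`; cubes with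
interior balls only). Proof: write `N = L·m² + s·m + t` with `m = ⌊N^{1/3}⌋` (`icbrt`, via
`Nat.findGreatest`), `L = ⌊N/m²⌋ ≥ m`, `s, t < m`; the staircase `stair m L s` of
`StickySpheres/FccStaircase.lean` plus `t` balls docked far away (monotonicity `maxContacts_mono`) has
deficit `Δ = 6t + 6Lm + 3m² + [s≠0](3s+2m) − L − 2m − [s≠0]` (`six_mul_le_maxContacts_add_stairDeficit`);
for `m ≥ 13`, `Δ(m+1) ≤ 10N` by an explicit polynomial inequality (`stairDeficit_mul_le`, `nlinarith` with
four product hints) and `N ≤ (m+1)³`; for `m ≤ 12` the `12·7·13·13` cases `(m, L − m, s, t)` are a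
kernel-evaluated table (`stairTableOK_all`, `decide +kernel`, plain `Nat` arithmetic) giving `Δ³ ≤ 1000·N²`
directly; finally `Δ³ ≤ 1000 N² ⇒ Δ ≤ 10·N^{2/3}`. The constant: the staircase family has deficit ratio
`Δ/N^{2/3} ≤ 9.84` (worst at `N = 7`, the straight chain) and `→ 9` (cubes); the conjecturally optimal
truncated-octahedron constant is `∛486 ≈ 7.86`, not pursued. Nothing is claimed about ground-state
geometry; the counting consequences for `BulkCrystallization3D` (constants `702 = 13·54`, `1296 = 24·54`,
`108 = 2·54`) are NOT re-instantiated here.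
-/

noncomputable section

open scoped BigOperators
open Finset

namespace Summit.Ventures.Crystal3D

/-! ## The all-`N` bound `6N − 10·N^{2/3} ≤ C(N)` -/

section AllN

/-- Integer cube root, rounded down: the largest `k ≤ N` with `k³ ≤ N`. -/
def icbrt (N : ℕ) : ℕ := Nat.findGreatest (fun k => k ^ 3 ≤ N) N

/-- `⌊N^{1/3}⌋³ ≤ N`. -/
theorem icbrt_pow_le (N : ℕ) : icbrt N ^ 3 ≤ N :=
  Nat.findGreatest_spec (P := fun k => k ^ 3 ≤ N) (Nat.zero_le N) (by simp)

/-- `⌊N^{1/3}⌋ ≤ N`. -/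
theorem icbrt_le (N : ℕ) : icbrt N ≤ N := Nat.findGreatest_le N

/-- `N < (⌊N^{1/3}⌋ + 1)³`. -/
theorem lt_succ_icbrt_pow (N : ℕ) : N < (icbrt N + 1) ^ 3 := by
  by_cases h : icbrt N + 1 ≤ N
  · have := Nat.findGreatest_is_greatest (P := fun k => k ^ 3 ≤ N) (Nat.lt_succ_self _) h
    exact not_le.1 this
  · have h1 : N ≤ icbrt N := by omega
    calc N ≤ icbrt N := h1
      _ < icbrt N + 1 := Nat.lt_succ_self _
      _ ≤ (icbrt N + 1) ^ 3 := Nat.le_self_pow (by norm_num) _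

/-- `1 ≤ ⌊N^{1/3}⌋` for `N ≥ 1`. -/
theorem one_le_icbrt {N : ℕ} (hN : 1 ≤ N) : 1 ≤ icbrt N :=
  Nat.le_findGreatest (P := fun k => k ^ 3 ≤ N) hN (by simpa using hN)

/-- The indicator of `s ≠ 0`, as a real number. -/
def ind (s : ℕ) : ℝ := if s = 0 then 0 else 1

/-- `ind 0 = 0`. -/
@[simp] theorem ind_zero : ind 0 = 0 := by simp [ind]

/-- `ind s = 1` for `s ≠ 0`. -/
theorem ind_of_ne_zero {s : ℕ} (h : s ≠ 0) : ind s = 1 := by simp [ind, h]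

/-- The real deficit bound of the staircase with `t` extra balls docked far away:
`Δ = 6t + 6Lm + 3m² + [s≠0](3s+2m) − L − 2m − [s≠0]`. -/
def stairDeficit (m L s t : ℕ) : ℝ :=
  6 * (t : ℝ) + 6 * (L : ℝ) * (m : ℝ) + 3 * (m : ℝ) * (m : ℝ) +
    ind s * (3 * (s : ℝ) + 2 * (m : ℝ)) - (L : ℝ) - 2 * (m : ℝ) - ind s

/-- The deficit identity over `ℝ`. -/
theorem stairContacts_identity_real {m L s : ℕ} (hm : 1 ≤ m) (hL : 1 ≤ L) :
    6 * ((L : ℝ) * m * m + s * m) + L + 2 * m + ind s =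
      (stairContacts m L s : ℝ) + 6 * L * m + 3 * m * m + ind s * (3 * s + 2 * m) := by
  have h := stairContacts_identity (s := s) hm hL
  by_cases hs0 : s = 0
  · subst hs0
    simp only [if_true, add_zero, zero_mul] at h
    simp only [ind_zero, add_zero, zero_mul, mul_zero, Nat.cast_zero]
    exact_mod_cast h
  · simp only [hs0, if_false] at h
    simp only [ind_of_ne_zero hs0, one_mul]
    exact_mod_cast h

/-- **Deficit bound**: `6N ≤ C(N) + Δ` for `N = L·m² + s·m + t` (`m, L ≥ 1`, `s < m`). -/
theorem six_mul_le_maxContacts_add_stairDeficit {m L s t : ℕ} (hm : 1 ≤ m) (hL : 1 ≤ L)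
    (hs : s < m) :
    6 * ((L * m * m + s * m + t : ℕ) : ℝ) ≤
      (maxContacts 3 (L * m * m + s * m + t) : ℝ) + stairDeficit m L s t := by
  have hC := stairContacts_le_maxContacts hm hL hs
  have hmono : maxContacts 3 (L * m * m + s * m) ≤ maxContacts 3 (L * m * m + s * m + t) :=
    maxContacts_mono (Nat.le_add_right _ _)
  have hC' : (stairContacts m L s : ℝ) ≤ (maxContacts 3 (L * m * m + s * m + t) : ℝ) := by
    exact_mod_cast hC.trans hmono
  have hid := stairContacts_identity_real (s := s) hm hL
  simp only [stairDeficit]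
  push_cast
  linarith

/-- **Large cubes** (`m ≥ 13`): `Δ·(m+1) ≤ 10N`. -/
theorem stairDeficit_mul_le {m L s t : ℕ} (hm : 13 ≤ m) (hL : m ≤ L) (hs : s < m) (ht : t < m) :
    stairDeficit m L s t * ((m : ℝ) + 1) ≤ 10 * ((L * m * m + s * m + t : ℕ) : ℝ) := by
  have hmR : (13 : ℝ) ≤ m := by exact_mod_cast hm
  have hLR : (m : ℝ) ≤ L := by exact_mod_cast hL
  have hsR : (s : ℝ) + 1 ≤ m := by exact_mod_cast hs
  have htR : (t : ℝ) + 1 ≤ m := by exact_mod_cast ht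
  have h1 : 0 ≤ ((L : ℝ) - m) * (4 * m ^ 2 - 5 * m + 1) :=
    mul_nonneg (by linarith) (by nlinarith)
  have h2 : 0 ≤ ((m : ℝ) - 1 - t) * (6 * m - 4) := mul_nonneg (by linarith) (by linarith)
  have h4 : (0 : ℝ) ≤ (m - 13) * (m ^ 2 - m + 6) := mul_nonneg (by linarith) (by nlinarith)
  push_cast
  by_cases hs0 : s = 0
  · subst hs0
    simp only [stairDeficit, ind_zero, Nat.cast_zero]
    nlinarith [h1, h2, h4]
  · have hs1 : (1 : ℝ) ≤ s := by exact_mod_cast Nat.pos_of_ne_zero hs0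
    have h3 : 0 ≤ ((s : ℝ) - 1) * (7 * m - 3) := mul_nonneg (by linarith) (by linarith)
    simp only [stairDeficit, ind_of_ne_zero hs0]
    nlinarith [h1, h2, h3, h4]

/-- The table entry for small cubes: `L + 2m + [s≠0] ≤ 6Lm + 3m² + [s≠0](3s+2m)` and `Δ³ ≤ 1000·N²`,
for `L = m + j`, under the range conditions. -/
def stairTableOK (m j s t : ℕ) : Bool :=
  decide (s < m → t < m → (m + j) * m * m + s * m + t < (m + 1) ^ 3 →
    (m + j) + 2 * m + (if s = 0 then 0 else 1) ≤
        6 * (m + j) * m + 3 * m * m + (if s = 0 then 0 else 3 * s + 2 * m) ∧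
      (6 * (m + j) * m + 3 * m * m + (if s = 0 then 0 else 3 * s + 2 * m) -
            ((m + j) + 2 * m + (if s = 0 then 0 else 1)) + 6 * t) ^ 3 ≤
        1000 * ((m + j) * m * m + s * m + t) ^ 2)

/-- **Small cubes** (`m ≤ 12`, `j ≤ 6`, `s, t ≤ 12`): all `12·7·13·13` table entries hold (kernel
evaluation). -/
theorem stairTableOK_all :
    ((List.range 13).all fun m => (List.range 7).all fun j => (List.range 13).all fun s =>
      (List.range 13).all fun t => stairTableOK m j s t) = true := by
  decide +kernel

/-- One table entry, read off `stairTableOK_all`. -/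
theorem stairDeficit_table {m j s t : ℕ} (hm : m < 13) (hj : j < 7) (hs13 : s < 13) (ht13 : t < 13)
    (hs : s < m) (ht : t < m) (hlt : (m + j) * m * m + s * m + t < (m + 1) ^ 3) :
    (m + j) + 2 * m + (if s = 0 then 0 else 1) ≤
        6 * (m + j) * m + 3 * m * m + (if s = 0 then 0 else 3 * s + 2 * m) ∧
      (6 * (m + j) * m + 3 * m * m + (if s = 0 then 0 else 3 * s + 2 * m) -
            ((m + j) + 2 * m + (if s = 0 then 0 else 1)) + 6 * t) ^ 3 ≤
        1000 * ((m + j) * m * m + s * m + t) ^ 2 := by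
  have h := stairTableOK_all
  simp only [List.all_eq_true, List.mem_range] at h
  have h' := h m hm j hj s hs13 t ht13
  rw [stairTableOK, decide_eq_true_eq] at h'
  exact h' hs ht hlt

/-- From `Δ³ ≤ 1000 N²` to `Δ ≤ 10 N^{2/3}`. -/
theorem le_ten_mul_rpow_of_pow_le {Δ N : ℝ} (hΔ : 0 ≤ Δ) (hN : 0 ≤ N)
    (h : Δ ^ 3 ≤ 1000 * N ^ 2) : Δ ≤ 10 * N ^ ((2 : ℝ) / 3) := by
  have h3 : Δ = (Δ ^ 3) ^ ((3 : ℝ)⁻¹) := by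
    rw [← Real.rpow_natCast, ← Real.rpow_mul hΔ]; norm_num
  have h10 : (10 : ℝ) * N ^ ((2 : ℝ) / 3) = (1000 * N ^ 2) ^ ((3 : ℝ)⁻¹) := by
    rw [Real.mul_rpow (by norm_num) (by positivity)]
    congr 1
    · rw [show (1000 : ℝ) = 10 ^ (3 : ℕ) by norm_num, ← Real.rpow_natCast,
        ← Real.rpow_mul (by norm_num)]; norm_num
    · rw [← Real.rpow_natCast, ← Real.rpow_mul hN]; norm_num
  rw [h3, h10]
  exact Real.rpow_le_rpow (by positivity) h (by norm_num)

/-- **The all-`N` fcc lower bound with constant `10`**: `6N − 10·N^{2/3} ≤ C(N)` for every `N`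
(the staircase construction has deficit ratio `≤ 9.84`, attained at `N = 7`, and `→ 9`; the constant
of the tree's `six_mul_sub_rpow_le_maxContacts` is `54`). -/
theorem six_mul_sub_ten_mul_rpow_le_maxContacts (N : ℕ) :
    6 * (N : ℝ) - 10 * (N : ℝ) ^ ((2 : ℝ) / 3) ≤ (maxContacts 3 N : ℝ) := by
  rcases Nat.eq_zero_or_pos N with rfl | hN
  · simp [Real.zero_rpow (by norm_num : ((2 : ℝ) / 3) ≠ 0)]
  -- parameters of the staircase
  set m := icbrt N with hm_def
  have hm1 : 1 ≤ m := one_le_icbrt hN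
  have hm3 : m ^ 3 ≤ N := icbrt_pow_le N
  have hN3 : N < (m + 1) ^ 3 := lt_succ_icbrt_pow N
  have hmm : 0 < m * m := Nat.mul_pos hm1 hm1
  set L := N / (m * m) with hL_def
  set r := N % (m * m) with hr_def
  set s := r / m with hs_def
  set t := r % m with ht_def
  have hN1 : N = m * m * L + r := (Nat.div_add_mod N (m * m)).symm
  have hr1 : r = m * s + t := (Nat.div_add_mod r m).symm
  have hr2 : r < m * m := Nat.mod_lt _ hmm
  have ht2 : t < m := Nat.mod_lt _ hm1
  have hs2 : s < m := (Nat.div_lt_iff_lt_mul hm1).2 hr2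
  have hNeq : N = L * m * m + s * m + t := by rw [hN1, hr1]; ring
  have hLm : m ≤ L := by
    rw [hL_def, Nat.le_div_iff_mul_le hmm]
    calc m * (m * m) = m ^ 3 := by ring
      _ ≤ N := hm3
  have hL1 : 1 ≤ L := hm1.trans hLm
  -- the deficit bound
  have hdef := six_mul_le_maxContacts_add_stairDeficit (t := t) hm1 hL1 hs2
  rw [← hNeq] at hdef
  have hNR : (0 : ℝ) ≤ N := Nat.cast_nonneg N
  -- Δ ≥ 0 and Δ³ ≤ 1000 N²
  have hcube : 0 ≤ stairDeficit m L s t ∧ stairDeficit m L s t ^ 3 ≤ 1000 * (N : ℝ) ^ 2 := by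
    by_cases hbig : 13 ≤ m
    · have hmul := stairDeficit_mul_le (t := t) hbig hLm hs2 ht2
      rw [← hNeq] at hmul
      have hm1R : (0 : ℝ) < (m : ℝ) + 1 := by positivity
      have hN3R : (N : ℝ) ≤ ((m : ℝ) + 1) ^ 3 := by exact_mod_cast hN3.le
      have hΔ0 : 0 ≤ stairDeficit m L s t := by
        have hmR : (13 : ℝ) ≤ m := by exact_mod_cast hbig
        have hLR : (m : ℝ) ≤ L := by exact_mod_cast hLm
        by_cases hs0 : s = 0
        · simp only [stairDeficit, hs0, ind_zero, Nat.cast_zero]; nlinarith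
        · have hs1 : (1 : ℝ) ≤ s := by exact_mod_cast Nat.pos_of_ne_zero hs0
          simp only [stairDeficit, ind_of_ne_zero hs0]; nlinarith
      refine ⟨hΔ0, ?_⟩
      have hle : stairDeficit m L s t ≤ 10 * N / ((m : ℝ) + 1) := by
        rw [le_div_iff₀ hm1R]; exact hmul
      calc stairDeficit m L s t ^ 3 ≤ (10 * N / ((m : ℝ) + 1)) ^ 3 :=
            pow_le_pow_left₀ hΔ0 hle 3
        _ = 1000 * (N : ℝ) ^ 2 * ((N : ℝ) / ((m : ℝ) + 1) ^ 3) := by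
            field_simp; ring
        _ ≤ 1000 * (N : ℝ) ^ 2 * 1 := by
            refine mul_le_mul_of_nonneg_left ?_ (by positivity)
            rw [div_le_one (by positivity)]; exact hN3R
        _ = 1000 * (N : ℝ) ^ 2 := mul_one _
    · push Not at hbig
      -- the table case: L = m + j with j < 7
      have hL7 : L < m + 7 := by
        rw [hL_def, Nat.div_lt_iff_lt_mul hmm]
        calc N < (m + 1) ^ 3 := hN3
          _ ≤ (m + 7) * (m * m) := by nlinarith
      obtain ⟨j, hj, hLj⟩ : ∃ j, j < 7 ∧ L = m + j := ⟨L - m, by omega, by omega⟩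
      have hlt : (m + j) * m * m + s * m + t < (m + 1) ^ 3 := by rw [← hLj, ← hNeq]; exact hN3
      obtain ⟨hBA, hcub⟩ := stairDeficit_table hbig hj (by omega) (by omega) hs2 ht2 hlt
      rw [← hLj] at hBA hcub
      rw [← hNeq] at hcub
      -- identify the natural-number expression with Δ
      have hΔ : stairDeficit m L s t =
          ((6 * L * m + 3 * m * m + (if s = 0 then 0 else 3 * s + 2 * m) -
              (L + 2 * m + (if s = 0 then 0 else 1)) + 6 * t : ℕ) : ℝ) := by
        rw [Nat.cast_add, Nat.cast_sub hBA]
        by_cases hs0 : s = 0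
        · simp only [stairDeficit, hs0, ind_zero, if_true]; push_cast; ring
        · simp only [stairDeficit, hs0, ind_of_ne_zero hs0, if_false]; push_cast; ring
      refine ⟨by rw [hΔ]; exact Nat.cast_nonneg _, ?_⟩
      rw [hΔ]
      exact_mod_cast hcub
  have hfin := le_ten_mul_rpow_of_pow_le hcube.1 hNR hcube.2
  linarith

end AllN

end Summit.Ventures.Crystal3D

end
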